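import Literature.Computability.AlgebraicComplexity.BCGPUInfiniteGroups
import Literature.Computability.AlgebraicComplexity.FlatteningBound
import HarnessLib

/-!
# BCGPU 2024, Theorem 2.2 with the right-quotient TPP is false: a counterexample in `S₃`

Topic `Literature/Computability/AlgebraicComplexity`; sibling of `BCGPUInfiniteGroups.lean` (the
named fact `BCGPU2024_thm_2_2`) and `BCGPUInfiniteGroupsProofs.lean` (the corrected statement
`BCGPU2024_thm_2_2_corrected`, proved). Source: J. Blasiak, H. Cohn, J. A. Grochow, K. Pratt,
C. Umans, *Finite matrix multiplication algorithms from infinite groups*, arXiv:2410.14905.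

`BCGPU2024_thm_2_2` renders Thm. 2.2 (p. 11) with "satisfying the TPP" read as the paper's own §1
definition (p. 2: "`x x'⁻¹ y y'⁻¹ z z'⁻¹ = 1 ⟺ x = x', y = y', z = z'`", the right-quotient form of
Cohn–Umans 2003, Def. 2.1 = the tree's `TripleProductProperty`) and with separating functions as in
Def. 2.1 (p. 10: `f_{x,z}(x z⁻¹) = 1`, `f_{x,z} = 0` on `X Y⁻¹ Y Z⁻¹ ∖ {x z⁻¹}`). The printed proof
uses instead, through eq. (2.1) (p. 10, "the TPP implies that `Ā · B̄ = ∑ (AB)[x,z](x z⁻¹) + E`"),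
the EMBEDDING form `x y⁻¹ y' z'⁻¹ = x₀ z₀⁻¹ ⟹ x = x₀, y = y', z' = z₀` (the form the source itself
verifies for its constructions, proof of Lemma 2.11, p. 22: "`x₁(ε)⁻¹x₂(ε)y₁(ε)⁻¹y₂(ε)z₁(ε)⁻¹z₂(ε)
= 1` … Equivalently `x₂(ε)y₁(ε)⁻¹y₂(ε)z₁(ε)⁻¹ = x₁(ε)z₂(ε)⁻¹`"), which in non-abelian groups is
not implied by the right-quotient form. This file PROVES that the statement as vendored is false
(`BCGPU2024_thm_2_2_false : ¬ BCGPU2024_thm_2_2`), by the following example.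

**Counterexample.** In `S₃` (here `Equiv.Perm (ULift (Fin 3))`, so that the statement is refuted at
every universe) let `b = (1 2)` (a reflection), `c = (0 1)(1 2)` (a rotation), `a = b c` (a
reflection), and `X = {1, a}`, `Y = {1}`, `Z = {b, c}`.
* Right-quotient TPP: `x x'⁻¹ ∈ {1, a}`, `z z'⁻¹ ∈ {1, b c⁻¹, c b⁻¹}` and `a ∉ {c b⁻¹, b c⁻¹}`, so
  `x x'⁻¹ · 1 · z z'⁻¹ = 1` forces `x = x'`, `z = z'` (`cx_tpp`, by `decide`).
* But `X Y⁻¹ Y Z⁻¹ = X Z⁻¹ = {b, c⁻¹}` has only two elements (`1 · b⁻¹ = a c⁻¹ = b`,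
  `1 · c⁻¹ = a b⁻¹ = c⁻¹`), of opposite signs; hence `f_{x,z} = (1 + sgn(x z⁻¹) · sgn)/2` is a
  set of separating functions (Def. 2.1) inside `RepFun{triv, sgn}` (`cx_separating`, `cx_mem`).
* Thm. 2.2 would give `(2·1·2)^{ω/3} ≤ 1^ω + 1^ω = 2`, i.e. `ω ≤ 3/2`, contradicting `ω ≥ 2`
  (`omega_two_le`, `FlatteningBound.lean`).

The corrected theorem (TPP in embedding form, as the `MatrixMultiplication` routes state it) is
`BCGPU2024_thm_2_2_corrected_holds` in `BCGPUInfiniteGroupsProofs.lean`.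

## References

* [BlasiakCohnGrochowPrattUmans2024] arXiv:2410.14905: §1 p. 2 (TPP), eq. (2.1) and Def. 2.1
  (p. 10), Thm. 2.2 (p. 11), proof pp. 12–13.
* [CohnUmans2003] H. Cohn, C. Umans, FOCS 2003: Def. 2.1 (right-quotient TPP), Thm. 2.3 (embedding
  with `x⁻¹y`, `y⁻¹z`, consistent with right quotients).
-/

noncomputable section

open scoped BigOperators

namespace Literature.Computability.AlgebraicComplexity

open Literature.Combinatorics.Additive (TripleProductProperty)

universe u

section Counterexample

open Equiv

/-! The data of the counterexample are fixed closed terms; they are introduced as local notations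
(not definitions), so that this file adds theorems only. -/

/-- `S₃` (as permutations of a copy of `Fin 3` in the ambient universe). -/
local notation "S3" => Perm (ULift (Fin 3))

/-- The reflection `b = (1 2)`. -/
local notation "cxB" => (swap (ULift.up (1 : Fin 3)) (ULift.up (2 : Fin 3)) : S3)

/-- The rotation `c = (0 1)(1 2)`. -/
local notation "cxC" =>
  (swap (ULift.up (0 : Fin 3)) (ULift.up (1 : Fin 3)) *
    swap (ULift.up (1 : Fin 3)) (ULift.up (2 : Fin 3)) : S3)

/-- `X = {1, a}` with the reflection `a = b c`. -/
local notation "cxX" => ({1, cxB * cxC} : Finset S3)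

/-- `Y = {1}`. -/
local notation "cxY" => ({1} : Finset S3)

/-- `Z = {b, c}`. -/
local notation "cxZ" => ({cxB, cxC} : Finset S3)

/-- The sign character as a complex number. -/
local notation "sgnC(" t ")" => (((Perm.sign t : ℤˣ) : ℤ) : ℂ)

/-- `R_sep = {triv, sgn}` as one-dimensional matrix representations `S₃ →* GL₁(ℂ)`. -/
local notation "cxRho" =>
  (![1, MonoidHom.comp (MonoidHom.comp (Units.map (RingHom.toMonoidHom
      (Matrix.scalar (Fin 1) : ℂ →+* Matrix (Fin 1) (Fin 1) ℂ)))
      (Units.map (RingHom.toMonoidHom (Int.castRingHom ℂ)))) Perm.sign] :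
    Fin 2 → (S3 →* Matrix.GeneralLinearGroup (Fin 1) ℂ))

/-- The separating functions `f_{x,z} = (1 + sgn(x z⁻¹) · sgn) / 2`. -/
local notation "cxF" => (fun (x z g : S3) => (1 + sgnC(x * z⁻¹) * sgnC(g)) / 2)

/-- `X, Y, Z` satisfy the right-quotient triple product property (Cohn–Umans 2003, Def. 2.1 = the
paper's §1 definition = the tree's `TripleProductProperty`).
[cite: BlasiakCohnGrochowPrattUmans2024, §1 (TPP, p. 2)] -/
private theorem cx_tpp : TripleProductProperty cxX cxY cxZ := by
  unfold TripleProductProperty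
  decide

/-- `|X| |Y| |Z| = 4`. [folklore] -/
private theorem cx_card : (cxX).card * (cxY).card * (cxZ).card = 4 := by
  decide

/-- The two elements of `X Z⁻¹ = {b, c⁻¹}` have opposite signs: `x' z'⁻¹ ≠ x z⁻¹` forces
`sgn(x' z'⁻¹) = -sgn(x z⁻¹)`. [folklore] -/
private theorem cx_sign : ∀ x ∈ cxX, ∀ z ∈ cxZ, ∀ x' ∈ cxX, ∀ z' ∈ cxZ,
    x' * z'⁻¹ ≠ x * z⁻¹ → Perm.sign (x' * z'⁻¹) = -Perm.sign (x * z⁻¹) := by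
  decide

/-- `sgn(g)² = 1` in `ℂ`. [folklore] -/
private theorem sgnC_mul_self (g : S3) : sgnC(g) * sgnC(g) = 1 := by
  rw [← Int.cast_mul, ← Units.val_mul, Int.units_mul_self, Units.val_one, Int.cast_one]

/-- The matrix coefficient of the second representation is the sign character. [folklore] -/
private theorem cxRho_one_apply (g : S3) (a b : Fin 1) :
    (((cxRho) 1 g : Matrix.GeneralLinearGroup (Fin 1) ℂ) : Matrix (Fin 1) (Fin 1) ℂ) a b =
      sgnC(g) := by
  simp [Subsingleton.elim a b, Matrix.intCast_apply]

/-- The matrix coefficient of the first representation is the constant `1`. [folklore] -/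
private theorem cxRho_zero_apply (g : S3) (a b : Fin 1) :
    (((cxRho) 0 g : Matrix.GeneralLinearGroup (Fin 1) ℂ) : Matrix (Fin 1) (Fin 1) ℂ) a b = 1 := by
  simp [Subsingleton.elim a b]

/-- `(f_{x,z})` is a set of separating functions for `(X, Y, Z)` in the sense of Def. 2.1.
[cite: BlasiakCohnGrochowPrattUmans2024, Def. 2.1] -/
private theorem cx_separating : IsSeparatingFamily cxX cxY cxZ cxF := by
  intro x hx z hz
  refine ⟨?_, ?_⟩
  · beta_reduce
    rw [sgnC_mul_self]
    norm_num
  · intro x' hx' y hy y' hy' z' hz' hne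
    have hy1 : y = 1 := Finset.mem_singleton.1 hy
    have hy1' : y' = 1 := Finset.mem_singleton.1 hy'
    subst hy1 hy1'
    simp only [inv_one, mul_one] at hne ⊢
    have hs' : sgnC(x' * z'⁻¹) = -sgnC(x * z⁻¹) := by
      simp only [cx_sign x hx z hz x' hx' z' hz' hne, Units.val_neg, Int.cast_neg]
    rw [hs', mul_neg, sgnC_mul_self]
    norm_num

/-- Each `f_{x,z}` lies in `RepFun{triv, sgn}`.
[cite: BlasiakCohnGrochowPrattUmans2024, §2.1 (RepFun, p. 11)] -/
private theorem cx_mem (x z : S3) : cxF x z ∈ repFun (fun _ : Fin 2 => 1) cxRho := by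
  have h0 : (fun _ : S3 => (1 : ℂ)) ∈ repFun (fun _ : Fin 2 => 1) cxRho :=
    Submodule.subset_span ⟨0, 0, 0, by funext g; exact (cxRho_zero_apply g 0 0).symm⟩
  have h1 : (fun g : S3 => sgnC(g)) ∈ repFun (fun _ : Fin 2 => 1) cxRho :=
    Submodule.subset_span ⟨1, 0, 0, by funext g; exact (cxRho_one_apply g 0 0).symm⟩
  have hf : cxF x z = (1 / 2 : ℂ) • (fun _ : S3 => (1 : ℂ)) +
      (sgnC(x * z⁻¹) / 2) • (fun g : S3 => sgnC(g)) := by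
    funext g
    simp only [Pi.add_apply, Pi.smul_apply, smul_eq_mul]
    ring
  rw [hf]
  exact Submodule.add_mem _ (Submodule.smul_mem _ _ h0) (Submodule.smul_mem _ _ h1)

/-- **`BCGPU2024_thm_2_2` (Thm. 2.2 with the right-quotient TPP of the paper's §1 and Def. 2.1 as
printed) is false**, at every universe: for `X = {1, a}`, `Y = {1}`, `Z = {b, c} ⊆ S₃` and
`R_sep = {triv, sgn}` it asserts `4^{ω/3} ≤ 2`, contradicting `ω ≥ 2`. The theorem holds with the
TPP in embedding form (`BCGPU2024_thm_2_2_corrected_holds`, `BCGPUInfiniteGroupsProofs.lean`).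
[cite: BlasiakCohnGrochowPrattUmans2024, Thm. 2.2] -/
theorem BCGPU2024_thm_2_2_false : ¬ BCGPU2024_thm_2_2.{u} := by
  intro h
  have hmain := h S3 cxX cxY cxZ cx_tpp (Fin 2) (fun _ => 1) cxRho cxF cx_separating
    (fun x _ z _ => cx_mem x z)
  rw [cx_card] at hmain
  simp only [Nat.cast_ofNat, Nat.cast_one, Real.one_rpow, Fin.sum_univ_two] at hmain
  have h1 : (4 : ℝ) ^ ((2 : ℝ) / 3) ≤ (4 : ℝ) ^ (omega ℂ / 3) :=
    Real.rpow_le_rpow_of_exponent_le (by norm_num) (by linarith [omega_two_le (K := ℂ)])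
  have h2 : (2 : ℝ) < 4 ^ ((2 : ℝ) / 3) := by
    rw [show (4 : ℝ) = 2 ^ (2 : ℝ) by norm_num, ← Real.rpow_mul (by norm_num : (0 : ℝ) ≤ 2)]
    conv_lhs => rw [← Real.rpow_one 2]
    exact Real.rpow_lt_rpow_of_exponent_lt (by norm_num) (by norm_num)
  linarith

end Counterexample

end Literature.Computability.AlgebraicComplexity

end
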